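import Summits.CriticalPhenomena.PercolationContinuityZ3.Theorems.PercNearOneGluingNoHeavyLowerTailTwoPartitionHallSplit
import Mathlib.Data.Nat.Choose.Sum
import Mathlib.Data.Finset.Interval
import HarnessLib.Audit

/-!
# `NoHeavyLowerTail` (crux stmt-CriticalPhenomena-4575), master-family hierarchy P3 (gen 33): the LINEAR ALGEBRA behind the proof of
# the core `CorePair` / `ThreeSetHallD` / `ThreeSetAntipodal` — dual functionals of the monomial basis on an up-set, Möbius steps,
# and the shattering descent

Support file (seat `prim-masterthm-p3`; `--supports stmt-CriticalPhenomena-4575`; memo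
`run/shared/lean/prim/prim-masterthm/FROM-prim-masterthm-p3-g33-CORE-PROVED.md`, HIERARCHY §40).  Companion of `…TwoPartitionHallSplit`
(`coreFn`, `CoreOn`, `CorePair ↔ ThreeSetHallD → ThreeSetAntipodal`); the proof of the core itself is completed in `…TwoPartitionCoreProof`.

THE ARGUMENT (this work; all sums are finite sums over the subsets of a finite type, values in `ℚ`).  For an up-set `𝒱` write
`σ𝒱 = {S : Sᶜ ∈ 𝒱}` and `m_U = [U ⊆ ·]` (the "monomial" of `U`).
* **Dual functionals** (`lam_incl`).  For `S` with `Sᶜ ∈ 𝒱` put `w_S(T) = ∑_{R ∈ 𝒱, R ⊆ T, R ∩ S = ∅} (−1)^{#R}` and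
  `Λ_S(f) = ∑_{T ∈ 𝒱} (−1)^{#T} w_S(T) f(T)`.  Then `Λ_S(m_U) = [U = S]·(−1)^{#U}` whenever `Uᶜ ∈ 𝒱`: swapping the two sums,
  `∑_{T ⊇ U ∪ R} (−1)^{#T} = [U ∪ R = univ]·(−1)^n` (every such `T` lies in `𝒱` because `R ∈ 𝒱`), and then `R` runs over the
  interval `[Uᶜ, Sᶜ]` (inside `𝒱` because `Uᶜ ∈ 𝒱`), whose alternating sum is `[U = S]`.  So `{m_U|_𝒱 : Uᶜ ∈ 𝒱}` is a basis of
  `ℚ^𝒱` with an EXPLICIT dual basis — a signed form of "the disjointness matrix of a simplicial complex is unimodular".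
* **Möbius steps** (`sum_disjoint_eq_sum_powerset`, `eq_zero_of_upsum_eq_zero`, `eq_zero_of_topsum_eq_zero`): the usual
  inclusion–exclusion identities `[R ∩ S = ∅] = ∑_{U ⊆ S ∩ R} (−1)^{#U}` and `∑_{A ⊆ U ⊆ B} (−1)^{#U} = [A = B](−1)^{#A}`.
* **Shattering descent** (`upsum_eq_zero`; the linear-algebra proof of Pajor's / the reverse Sauer–Shelah inequality — Frankl–Pach 1983,
  Anstee–Rónyai–Sali 2002 "the monomials of the shattered sets span the functions on the family" — in exactly the form needed here):
  if `k` is a function with `∑_{R ∈ ℰ, R ∩ S = ∅} k(R) = 0` for every `S` lying below one member of `ℰ` and disjoint from another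
  (in particular for every set shattered by `ℰ`), then ALL up-sums `∑_{R ∈ ℰ, R ⊇ U} k(R)` vanish (strong induction on `U`), hence
  `k = 0` on `ℰ`.
HONEST LABEL: elementary identities, fully proved (standard axioms); nothing here is specific to the crux.  The theorem they serve —
`CoreOn`, hence `CorePair`, `ThreeSetHallD`, `ThreeSetHallG2`, `ThreeSetHallG`, `ThreeSetHall`, `ThreeSetAntipodal` and SQKD for every
product measure — is in `…TwoPartitionCoreProof`. [this work]
-/

namespace Summit.CriticalPhenomena.PercolationContinuityZ3.Theorems.TwoPartition

open Finset
open scoped FinsetFamily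

section Sign
variable {α : Type*} [DecidableEq α]

/-- The sign `(−1)^{#T}` of a finite set, in `ℚ`. [folklore] -/
def sgn (T : Finset α) : ℚ := (-1) ^ #T

omit [DecidableEq α] in
/-- `sgn T * sgn T = 1`. [folklore] -/
theorem sgn_mul_self (T : Finset α) : sgn T * sgn T = 1 := by
  unfold sgn; rw [← pow_add, ← two_mul, pow_mul]; norm_num

omit [DecidableEq α] in
/-- `sgn T ≠ 0`. [folklore] -/
theorem sgn_ne_zero (T : Finset α) : sgn T ≠ 0 := by
  unfold sgn; exact pow_ne_zero _ (by norm_num)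

/-- `sgn (A ∪ B) = sgn A * sgn B` for disjoint `A, B`. [folklore] -/
theorem sgn_union {A B : Finset α} (h : Disjoint A B) : sgn (A ∪ B) = sgn A * sgn B := by
  unfold sgn; rw [card_union_of_disjoint h, pow_add]

/-- The alternating sum over a power set (in `ℚ`): `∑_{S ⊆ X} (−1)^{#S} = [X = ∅]`. [folklore] -/
theorem sum_powerset_sgn (X : Finset α) : ∑ S ∈ X.powerset, sgn S = if X = ∅ then 1 else 0 := by
  unfold sgn
  have h := Finset.sum_powerset_neg_one_pow_card (x := X)
  have : ((∑ m ∈ X.powerset, (-1 : ℤ) ^ #m : ℤ) : ℚ) = ∑ m ∈ X.powerset, (-1 : ℚ) ^ #m := by push_cast; rfl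
  rw [← this, h]; push_cast; split_ifs <;> simp

/-- The alternating sum over an interval of the Boolean lattice, written as a sum over all subsets with an indicator:
`∑_{A ⊆ U ⊆ B} (−1)^{#U} = [A = B]·(−1)^{#A}` (for a finite type). [folklore] -/
theorem sum_Icc_sgn [Fintype α] (A B : Finset α) :
    (∑ U, if A ⊆ U ∧ U ⊆ B then sgn U else 0) = if A = B then sgn A else 0 := by
  by_cases hAB : A ⊆ B
  · have h1 : (∑ U, if A ⊆ U ∧ U ⊆ B then sgn U else 0) = ∑ U ∈ Finset.Icc A B, sgn U := by
      rw [← Finset.sum_filter]; congr 1; ext U; simp [Finset.mem_Icc]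
    rw [h1, Finset.Icc_eq_image_powerset hAB, Finset.sum_image]
    · have h2 : ∀ X ∈ (B \ A).powerset, sgn (A ∪ X) = sgn A * sgn X := by
        intro X hX
        rw [mem_powerset] at hX
        exact sgn_union (disjoint_of_subset_right hX disjoint_sdiff)
      rw [Finset.sum_congr rfl h2, ← Finset.mul_sum, sum_powerset_sgn]
      by_cases hE : A = B
      · subst hE; simp
      · have : B \ A ≠ ∅ := by
          intro h; apply hE; exact Subset.antisymm hAB (sdiff_eq_empty_iff_subset.1 h)
        rw [if_neg this, if_neg hE, mul_zero]
    · intro X hX X' hX' hXX'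
      rw [mem_coe, mem_powerset] at hX hX'
      have dX : Disjoint A X := disjoint_of_subset_right hX disjoint_sdiff
      have dX' : Disjoint A X' := disjoint_of_subset_right hX' disjoint_sdiff
      have := congrArg (· \ A) hXX'
      simpa [union_sdiff_left, dX.symm.sdiff_eq_left, dX'.symm.sdiff_eq_left] using this
  · have h1 : ∀ U, ¬ (A ⊆ U ∧ U ⊆ B) := fun U h => hAB (h.1.trans h.2)
    have hne : A ≠ B := fun h => hAB (h ▸ Subset.rfl)
    simp [h1, hne]

end Sign

/-! ### The dual functionals `Λ_S` of the monomial basis `{[U ⊆ ·] : Uᶜ ∈ 𝒱}` of functions on an up-set `𝒱` -/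

section Dual
variable {α : Type*} [DecidableEq α] [Fintype α]

/-- The inclusion indicator ("monomial") `[S ⊆ T]`, in `ℚ`. [folklore] -/
def incl (S T : Finset α) : ℚ := if S ⊆ T then 1 else 0

/-- The weight `w_S(T) = ∑_{R ∈ 𝒱, R ⊆ T, R ∩ S = ∅} (−1)^{#R}` of the dual functional. [this work] -/
def wfun (𝒱 : Finset (Finset α)) (S T : Finset α) : ℚ := ∑ R, if R ∈ 𝒱 ∧ R ⊆ T ∧ Disjoint R S then sgn R else 0

/-- The dual functional `Λ_S(f) = ∑_{T ∈ 𝒱} (−1)^{#T} · w_S(T) · f(T)`. [this work] -/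
def lam (𝒱 : Finset (Finset α)) (S : Finset α) (f : Finset α → ℚ) : ℚ :=
  ∑ T, if T ∈ 𝒱 then sgn T * wfun 𝒱 S T * f T else 0

omit [Fintype α] in
/-- `R ∩ S = ∅ ↔ R ⊆ Sᶜ`. [folklore] -/
theorem disjoint_iff_subset_compl [Fintype α] (R S : Finset α) : Disjoint R S ↔ R ⊆ Sᶜ := by
  rw [Finset.disjoint_left]
  exact ⟨fun h x hx => mem_compl.2 (h hx), fun h x hx hs => (mem_compl.1 (h hx)) hs⟩

/-- `U ∪ R = univ ↔ Uᶜ ⊆ R`. [folklore] -/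
theorem union_eq_univ_iff_compl_subset (U R : Finset α) : U ∪ R = univ ↔ Uᶜ ⊆ R := by
  constructor
  · intro h x hx
    have hx' : x ∈ U ∪ R := h ▸ mem_univ x
    exact (mem_union.1 hx').resolve_left (mem_compl.1 hx)
  · intro h
    exact eq_univ_of_forall fun x => by
      by_cases hx : x ∈ U
      · exact mem_union_left _ hx
      · exact mem_union_right _ (h (mem_compl.2 hx))

/-- `sgn univ * sgn Uᶜ = sgn U`. [folklore] -/
theorem sgn_univ_mul_sgn_compl (U : Finset α) : sgn (univ : Finset α) * sgn Uᶜ = sgn U := by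
  rw [← union_compl U, sgn_union disjoint_compl_right, mul_assoc, sgn_mul_self, mul_one]

/-- **The dual functionals** (this work): for an up-set `𝒱` and `S, U` with `Sᶜ, Uᶜ ∈ 𝒱`,
`Λ_S([U ⊆ ·]) = [U = S]·(−1)^{#U}`.  (Swap the sums: `∑_{T ⊇ U ∪ R} (−1)^{#T} = [U ∪ R = univ]·(−1)^n`, all such `T`
lying in `𝒱` because `R ∈ 𝒱`; then `R` runs over the interval `[Uᶜ, Sᶜ]`, inside `𝒱` because `Uᶜ ∈ 𝒱`.)  Hence the
functions `[U ⊆ ·]|_𝒱`, `Uᶜ ∈ 𝒱`, are linearly independent. [this work] -/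
theorem lam_incl {𝒱 : Finset (Finset α)} (h𝒱 : IsUpperSet (𝒱 : Set (Finset α))) {S U : Finset α} (hS : Sᶜ ∈ 𝒱)
    (hU : Uᶜ ∈ 𝒱) : lam 𝒱 S (incl U) = if U = S then sgn U else 0 := by
  -- (1) as a double sum over `(T, R)` with `R ∈ 𝒱`, `R ∩ S = ∅`, `U ∪ R ⊆ T`
  have h1 : lam 𝒱 S (incl U) = ∑ T, ∑ R, (if R ∈ 𝒱 ∧ Disjoint R S ∧ U ∪ R ⊆ T then sgn T * sgn R else 0) := by
    unfold lam wfun incl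
    refine Finset.sum_congr rfl fun T _ => ?_
    by_cases hT : T ∈ 𝒱
    · by_cases hUT : U ⊆ T
      · rw [if_pos hT, if_pos hUT, mul_one, Finset.mul_sum]
        refine Finset.sum_congr rfl fun R _ => ?_
        by_cases hR : R ∈ 𝒱 ∧ R ⊆ T ∧ Disjoint R S
        · rw [if_pos hR, if_pos ⟨hR.1, hR.2.2, union_subset hUT hR.2.1⟩]
        · rw [if_neg hR, mul_zero, if_neg]
          rintro ⟨h1, h2, h3⟩
          exact hR ⟨h1, subset_union_right.trans h3, h2⟩
      · rw [if_pos hT, if_neg hUT, mul_zero]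
        symm
        refine Finset.sum_eq_zero fun R _ => ?_
        rw [if_neg]
        rintro ⟨-, -, h3⟩
        exact hUT (subset_union_left.trans h3)
    · rw [if_neg hT]
      symm
      refine Finset.sum_eq_zero fun R _ => ?_
      rw [if_neg]
      rintro ⟨hR, -, h3⟩
      exact hT (h𝒱 (subset_union_right.trans h3) hR)
  rw [h1, Finset.sum_comm]
  -- (2) the inner sum over `T` is an interval sum
  have h2 : ∀ R, (∑ T, if R ∈ 𝒱 ∧ Disjoint R S ∧ U ∪ R ⊆ T then sgn T * sgn R else 0)
      = if Uᶜ ⊆ R ∧ R ⊆ Sᶜ then sgn (univ : Finset α) * sgn R else 0 := by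
    intro R
    by_cases hR : R ∈ 𝒱 ∧ Disjoint R S
    · have e1 : (∑ T, if R ∈ 𝒱 ∧ Disjoint R S ∧ U ∪ R ⊆ T then sgn T * sgn R else 0)
          = (∑ T, if U ∪ R ⊆ T ∧ T ⊆ univ then sgn T else 0) * sgn R := by
        rw [Finset.sum_mul]
        refine Finset.sum_congr rfl fun T _ => ?_
        by_cases h : U ∪ R ⊆ T
        · rw [if_pos ⟨hR.1, hR.2, h⟩, if_pos ⟨h, subset_univ _⟩]
        · rw [if_neg (fun h' => h h'.2.2), if_neg (fun h' => h h'.1), zero_mul]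
      rw [e1, sum_Icc_sgn]
      by_cases hu : U ∪ R = univ
      · rw [if_pos hu, hu, if_pos ⟨(union_eq_univ_iff_compl_subset U R).1 hu, (disjoint_iff_subset_compl R S).1 hR.2⟩]
      · rw [if_neg hu, zero_mul, if_neg]
        rintro ⟨h3, -⟩
        exact hu ((union_eq_univ_iff_compl_subset U R).2 h3)
    · have e2 : ¬ (Uᶜ ⊆ R ∧ R ⊆ Sᶜ) := by
        rintro ⟨h3, h4⟩
        exact hR ⟨h𝒱 h3 hU, (disjoint_iff_subset_compl R S).2 h4⟩
      rw [if_neg e2]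
      refine Finset.sum_eq_zero fun T _ => ?_
      rw [if_neg]
      rintro ⟨h3, h4, -⟩
      exact hR ⟨h3, h4⟩
  rw [Finset.sum_congr rfl fun R _ => h2 R]
  -- (3) the sum over `R` is an interval sum
  have h3 : (∑ R, if Uᶜ ⊆ R ∧ R ⊆ Sᶜ then sgn (univ : Finset α) * sgn R else 0)
      = sgn (univ : Finset α) * ∑ R, if Uᶜ ⊆ R ∧ R ⊆ Sᶜ then sgn R else 0 := by
    rw [Finset.mul_sum]
    refine Finset.sum_congr rfl fun R _ => ?_
    split_ifs <;> simp
  rw [h3, sum_Icc_sgn]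
  by_cases hUS : U = S
  · subst hUS
    rw [if_pos rfl, if_pos rfl, sgn_univ_mul_sgn_compl]
  · have : Uᶜ ≠ Sᶜ := fun h => hUS (compl_inj_iff.1 h)
    rw [if_neg this, if_neg hUS, mul_zero]

end Dual

/-! ### Möbius inversion steps and the shattering descent -/

section Descent
variable {α : Type*} [DecidableEq α] [Fintype α]

/-- Möbius over the subsets of `S`: `∑_{R ∈ ℰ, R ∩ S = ∅} k(R) = ∑_{U ⊆ S} (−1)^{#U} ∑_{R ∈ ℰ, R ⊇ U} k(R)`
(from `[R ∩ S = ∅] = ∑_{U ⊆ S ∩ R} (−1)^{#U}`). [folklore] -/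
theorem sum_disjoint_eq_sum_powerset (ℰ : Finset (Finset α)) (k : Finset α → ℚ) (S : Finset α) :
    (∑ R, if R ∈ ℰ ∧ Disjoint R S then k R else 0)
      = ∑ U ∈ S.powerset, sgn U * ∑ R, (if R ∈ ℰ ∧ U ⊆ R then k R else 0) := by
  have h1 : ∀ U ∈ S.powerset, sgn U * (∑ R, if R ∈ ℰ ∧ U ⊆ R then k R else 0)
      = ∑ R, (if R ∈ ℰ ∧ U ⊆ R then sgn U * k R else 0) := by
    intro U _
    rw [Finset.mul_sum]
    refine Finset.sum_congr rfl fun R _ => ?_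
    split_ifs <;> simp
  rw [Finset.sum_congr rfl h1, Finset.sum_comm]
  refine Finset.sum_congr rfl fun R _ => ?_
  by_cases hR : R ∈ ℰ
  · have h2 : (∑ U ∈ S.powerset, if R ∈ ℰ ∧ U ⊆ R then sgn U * k R else 0)
        = (∑ U ∈ (S ∩ R).powerset, sgn U) * k R := by
      rw [Finset.sum_mul, ← Finset.sum_filter]
      have e : S.powerset.filter (fun U => R ∈ ℰ ∧ U ⊆ R) = (S ∩ R).powerset := by
        ext U
        simp only [mem_filter, mem_powerset, subset_inter_iff, hR, true_and]
      rw [e]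
    rw [h2, sum_powerset_sgn]
    by_cases hd : Disjoint R S
    · rw [if_pos ⟨hR, hd⟩, if_pos (by rw [inter_comm]; exact disjoint_iff_inter_eq_empty.1 hd), one_mul]
    · rw [if_neg (fun h => hd h.2), if_neg (fun h => hd (disjoint_iff_inter_eq_empty.2 (by rw [inter_comm]; exact h))),
        zero_mul]
  · rw [if_neg (fun h => hR h.1)]
    symm
    exact Finset.sum_eq_zero fun U _ => if_neg (fun h => hR h.1)

/-- **The shattering descent** (the Frankl–Pach / Anstee–Rónyai–Sali argument that the monomials of the shattered sets span the
functions on a family; here in the form we need): if `∑_{R ∈ ℰ, R ∩ S = ∅} k(R) = 0` for every `S` that lies below one member of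
`ℰ` and is disjoint from another, then `∑_{R ∈ ℰ, R ⊇ U} k(R) = 0` for EVERY `U` (strong induction on `U`: a `U` above no member
gives an empty sum; a `U` disjoint from no member gives `∑_{R ∩ U = ∅} = 0` trivially; Möbius isolates the top term). [folklore] -/
theorem upsum_eq_zero (ℰ : Finset (Finset α)) (k : Finset α → ℚ)
    (hD : ∀ S : Finset α, ((∃ e ∈ ℰ, S ⊆ e) ∧ (∃ e ∈ ℰ, e ⊆ Sᶜ)) → (∑ R, if R ∈ ℰ ∧ Disjoint R S then k R else 0) = 0) :
    ∀ U : Finset α, (∑ R, if R ∈ ℰ ∧ U ⊆ R then k R else 0) = 0 := by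
  intro U
  induction U using Finset.strongInduction with
  | H U ih =>
    by_cases h1 : ∃ e ∈ ℰ, U ⊆ e
    · have hDk : (∑ R, if R ∈ ℰ ∧ Disjoint R U then k R else 0) = 0 := by
        by_cases h2 : ∃ e ∈ ℰ, e ⊆ Uᶜ
        · exact hD U ⟨h1, h2⟩
        · refine Finset.sum_eq_zero fun R _ => ?_
          rw [if_neg]
          rintro ⟨hR, hd⟩
          exact h2 ⟨R, hR, (disjoint_iff_subset_compl R U).1 hd⟩
      rw [sum_disjoint_eq_sum_powerset, ← Finset.add_sum_erase _ _ (mem_powerset_self U)] at hDk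
      have h3 : (∑ U' ∈ U.powerset.erase U, sgn U' * ∑ R, (if R ∈ ℰ ∧ U' ⊆ R then k R else 0)) = 0 := by
        refine Finset.sum_eq_zero fun U' hU' => ?_
        rw [mem_erase, mem_powerset] at hU'
        rw [ih U' (Finset.ssubset_iff_subset_ne.2 ⟨hU'.2, hU'.1⟩), mul_zero]
      rw [h3, add_zero] at hDk
      rcases mul_eq_zero.1 hDk with h | h
      · exact absurd h (sgn_ne_zero U)
      · exact h
    · refine Finset.sum_eq_zero fun R _ => ?_
      rw [if_neg]
      rintro ⟨hR, hUR⟩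
      exact h1 ⟨R, hR, hUR⟩

/-- Möbius upward: if all the up-sums `∑_{R ∈ ℰ, R ⊇ U} k(R)` vanish then `k` vanishes on `ℰ`. [folklore] -/
theorem eq_zero_of_upsum_eq_zero (ℰ : Finset (Finset α)) (k : Finset α → ℚ)
    (hK : ∀ U : Finset α, (∑ R, if R ∈ ℰ ∧ U ⊆ R then k R else 0) = 0) {R₀ : Finset α} (hR₀ : R₀ ∈ ℰ) : k R₀ = 0 := by
  have h1 : (∑ U, if R₀ ⊆ U then sgn U * ∑ R, (if R ∈ ℰ ∧ U ⊆ R then k R else 0) else 0) = 0 :=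
    Finset.sum_eq_zero fun U _ => by rw [hK U, mul_zero, ite_self]
  have h2 : (∑ U, if R₀ ⊆ U then sgn U * ∑ R, (if R ∈ ℰ ∧ U ⊆ R then k R else 0) else 0)
      = ∑ U, ∑ R, (if R ∈ ℰ ∧ R₀ ⊆ U ∧ U ⊆ R then sgn U * k R else 0) := by
    refine Finset.sum_congr rfl fun U _ => ?_
    by_cases hU : R₀ ⊆ U
    · rw [if_pos hU, Finset.mul_sum]
      refine Finset.sum_congr rfl fun R _ => ?_
      by_cases hR : R ∈ ℰ ∧ U ⊆ R
      · rw [if_pos hR, if_pos ⟨hR.1, hU, hR.2⟩]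
      · rw [if_neg hR, mul_zero, if_neg (fun h => hR ⟨h.1, h.2.2⟩)]
    · rw [if_neg hU]
      exact (Finset.sum_eq_zero fun R _ => by rw [if_neg (fun h => hU h.2.1)]).symm
  have h3 : ∀ R, (∑ U, if R ∈ ℰ ∧ R₀ ⊆ U ∧ U ⊆ R then sgn U * k R else 0)
      = if R ∈ ℰ then (if R₀ = R then sgn R₀ else 0) * k R else 0 := by
    intro R
    by_cases hR : R ∈ ℰ
    · rw [if_pos hR, ← sum_Icc_sgn, Finset.sum_mul]
      refine Finset.sum_congr rfl fun U _ => ?_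
      by_cases hU : R₀ ⊆ U ∧ U ⊆ R
      · rw [if_pos ⟨hR, hU⟩, if_pos hU]
      · rw [if_neg (fun h => hU h.2), if_neg hU, zero_mul]
    · rw [if_neg hR]
      exact Finset.sum_eq_zero fun U _ => by rw [if_neg (fun h => hR h.1)]
  rw [h2, Finset.sum_comm, Finset.sum_congr rfl fun R _ => h3 R] at h1
  have h4 : ∀ R, (if R ∈ ℰ then (if R₀ = R then sgn R₀ else 0) * k R else 0) = if R₀ = R then sgn R₀ * k R₀ else 0 := by
    intro R
    by_cases h : R₀ = R
    · subst h; rw [if_pos hR₀, if_pos rfl, if_pos rfl]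
    · rw [if_neg h]; split_ifs <;> simp
  rw [Finset.sum_congr rfl fun R _ => h4 R, Finset.sum_ite_eq] at h1
  simp only [mem_univ, if_true] at h1
  rcases mul_eq_zero.1 h1 with h | h
  · exact absurd h (sgn_ne_zero R₀)
  · exact h

/-- Top-down within `ℰ`: if `∑_{T ∈ ℰ, T ⊇ R} (−1)^{#T} f(T) = 0` for every `R ∈ ℰ` then `f` vanishes on `ℰ`. [folklore] -/
theorem eq_zero_of_topsum_eq_zero (ℰ : Finset (Finset α)) (f : Finset α → ℚ)
    (hH : ∀ R ∈ ℰ, (∑ T, if T ∈ ℰ ∧ R ⊆ T then sgn T * f T else 0) = 0) : ∀ T ∈ ℰ, f T = 0 := by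
  suffices h : ∀ W T : Finset α, Tᶜ = W → T ∈ ℰ → f T = 0 from fun T hT => h Tᶜ T rfl hT
  intro W
  induction W using Finset.strongInduction with
  | H W ih =>
    intro T hTW hT
    have h1 := hH T hT
    rw [← Finset.add_sum_erase _ _ (mem_univ T), if_pos ⟨hT, Subset.rfl⟩] at h1
    have h2 : (∑ T' ∈ (univ : Finset (Finset α)).erase T, if T' ∈ ℰ ∧ T ⊆ T' then sgn T' * f T' else 0) = 0 := by
      refine Finset.sum_eq_zero fun T' hT' => ?_
      by_cases h : T' ∈ ℰ ∧ T ⊆ T'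
      · have hlt : T ⊂ T' := Finset.ssubset_iff_subset_ne.2 ⟨h.2, (ne_of_mem_erase hT').symm⟩
        have hc : T'ᶜ ⊂ W := by rw [← hTW]; exact compl_lt_compl_iff_lt.2 hlt
        rw [if_pos h, ih T'ᶜ hc T' rfl h.1, mul_zero]
      · rw [if_neg h]
    rw [h2, add_zero] at h1
    rcases mul_eq_zero.1 h1 with h | h
    · exact absurd h (sgn_ne_zero T)
    · exact h

end Descent

end Summit.CriticalPhenomena.PercolationContinuityZ3.Theorems.TwoPartition
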